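import Summits.ResolutionOfSingularities.ResolutionOfSingularities.Theorems.PurityCutGrand
import Summits.ResolutionOfSingularities.ResolutionOfSingularities.Theorems.MaxContactCutCurveLeafExit
import HarnessLib

/-!
# MaxContactCutPurityCut — the decomp-res node «PurityCut» BY NAME on the host route `MaxContactCut` (lens-2 g16 rev
1, pin c1c78f8a)

Content VERBATIM from the decomp-res lens-2 g16 node `HOME/decomp-res-lens-2/g16/PurityCut.lean` rev 1 (pin c1c78f8a
= `parts/PurityCut-rev1-c1c78f8a.lean`, 2 025 l;
HOME = run/shared/lean/pub/decomp-res; CRITIC-LEDGER row 140 CLEARED; landing orders INBOX :288 (row-140 line: split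
/ order / asides) and :296 (land from rev 1:
docstring-only changes + eight ring-identity kernels).  The lens's §R (l. 121–1020: 89 declarations RESTATED
VERBATIM-IN-BODY from lens-2 g14 `PinchCut` rev 1 and
g15 `JetCut` rev 5) is DELETED — those are the tree's `PinchCutClasses` / `PinchCutKernels` / `JetCut*` modules
(namespaces `…Theorems.PinchCut`, `…Theorems.JetCut`
with its sub-namespace `Vast`, opened; same short names, byte-identical bodies — never two copies).  Namespace
`…Theorems.PurityCut` (the lens's `Theses.PurityCut`
is gate-reserved), sub-namespaces `Leaf` / `Grand` as in the lens; file split only (tree files ≤ 400 lines):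
sections, variables and every declaration exactly as in
the lens.  Node files, in import order: `PurityCutLeaf` (§G) · `PurityCutClasses` (§P, continued `…2` / `…3` as
needed) · `PurityCutGrand` (§H cone-free: the aside
home) · the wiring `MaxContactCutPurityCut` (§G/§H BY NAME on the host route, in the Theses cone).  All `--supports
stmt-ResolutionOfSingularities-29273`
(`MaxContactCut.RungOne`); nothing closes 29273 — decided halves carry their engines as hypotheses; exactly ONE
located-residual aside is booked on the route for
the lens-2 column (`Grand.GrandSpecialRung`, home `PurityCutGrand`), SUPERSEDING the JetCut residual
`Vast.VastSpecialRung` (critic :288: «if Vast is not yet filed,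
file Grand only; never both») and re-locating the tree aside 33866 `LeafSpecialRung` EXACTLY modulo the grand decided half.

THE WIRING of the node VERBATIM, BY NAME on the host route `MaxContactCut` (in the Theses cone), in lens order: §G
`Leaf.rungOne_iff : MaxContactCut.RungOne ⟺ GenericRung L ∧ SpecialRung L` for EVERY leaf `L`, `Leaf.closes`,
`Leaf.leafGenericRung_of_genericRung` (33865 BY NAME), `Leaf.specialRung_of_leafSpecialRung` /
**`Leaf.leafSpecialRung_iff_specialRung`** (EXACT re-location of the tree aside 33866 modulo the decided half),
`Leaf.specialRung_iff_of_le`; §H `Grand.rungOne_iff`, **`Grand.closes`** (29273 BY NAME from the two grand halves),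
`Grand.closes_of_engines`, **`Grand.vastSpecialRung_iff_grandSpecialRung`** (the JetCut residual ⟺ the grand
residual modulo the decided half), **`Grand.leafSpecialRung_iff_grandSpecialRung`** (tree aside 33866),
`leafGenericRung_of_grandGenericRung` (33865), `closes_of_vastSpecialRung` — 0 sorry.  Imports the aside home
`PurityCutGrand` and `MaxContactCutCurveLeafExit` (for `CurveLeafExit.leafSpecialRung_of_rungOne`).  Supports 29273.

This file carries: `Leaf.rungOne_iff`, `Leaf.genericRung_of_rungOne`, `Leaf.specialRung_of_rungOne`,
`Leaf.specialRung_iff_rungOne`, `Leaf.closes`, `Leaf.leafGenericRung_of_genericRung`,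
`Leaf.specialRung_of_leafSpecialRung`, `Leaf.leafSpecialRung_iff_specialRung`, `Leaf.specialRung_iff_of_le`,
`Grand.rungOne_iff`, `Grand.grandGenericRung_of_rungOne`, `Grand.grandSpecialRung_of_rungOne`,
`Grand.grandSpecialRung_iff_rungOne`, `Grand.closes`, `Grand.closes_of_engines`,
`Grand.vastSpecialRung_iff_grandSpecialRung`, `Grand.leafSpecialRung_iff_grandSpecialRung`,
`Grand.leafGenericRung_of_grandGenericRung`, `Grand.pinchSpecialRung_iff_grandSpecialRung`, `Grand.closes_of_vastSpecialRung`.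

(Sources: Hironaka1964 Ch. III; CossartJannsenSaito2020 Ch. 2, Ch. 8–9; CossartPiltant2008 Prop. 4.2;
CossartPiltant2019 Rem. 3.2; BierstoneGrigorievMilmanWlodarczyk2011 §3.1; Moh1987; Hauser2010Kangaroo; Giraud1975;
Narasimhan1983; HunekeSwanson2006 Cor. 5.5.5.)
-/

open CategoryTheory AlgebraicGeometry TopologicalSpace IsLocalRing
open Literature.AlgebraicGeometry.Resolution
open Summit.ResolutionOfSingularities.ResolutionOfSingularities.Theorems
open Summit.ResolutionOfSingularities.ResolutionOfSingularities.Theorems.WeakOrderReduction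
open Summit.ResolutionOfSingularities.ResolutionOfSingularities.Theorems.DeltaFaceCutClasses
open Summit.ResolutionOfSingularities.ResolutionOfSingularities.Theorems.RelativeDeltaCut
open Summit.ResolutionOfSingularities.ResolutionOfSingularities.Theorems.CurveLeafExit
open Summit.ResolutionOfSingularities.ResolutionOfSingularities.Theorems.PinchCut
open Summit.ResolutionOfSingularities.ResolutionOfSingularities.Theorems.JetCut
open Summit.ResolutionOfSingularities.ResolutionOfSingularities.Theses

namespace Summit.ResolutionOfSingularities.ResolutionOfSingularities.Theorems.PurityCut

namespace Leaf

variable (L : ∀ ⦃Y : Scheme.{0}⦄, Y.IdealSheafData → ℕ → Y → Prop)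

section Kernels

variable {L}
variable {n : ℕ}

/-- **EXACT AT THE RUNG**: `RungOne ⟺ GenericRung L ∧ SpecialRung L`. [folklore] -/
theorem rungOne_iff : MaxContactCut.RungOne ↔ GenericRung L ∧ SpecialRung L := by
  constructor
  · intro h
    exact ⟨fun hE2 n hn => seqGen_of_seqDimFour_one (h hE2 n hn),
      fun hE2 n hn => seqSpec_of_seqDimFour_one (h hE2 n hn)⟩
  · rintro ⟨hG, hS⟩ hE2 n hn
    exact (seqDimFour_one_iff (L := L)).mpr ⟨hG hE2 n hn, hS hE2 n hn⟩

/-- NECESSITY by letter. [folklore] -/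
theorem genericRung_of_rungOne (h : MaxContactCut.RungOne) : GenericRung L := ((rungOne_iff (L := L)).mp h).1

/-- NECESSITY by letter. [folklore] -/
theorem specialRung_of_rungOne (h : MaxContactCut.RungOne) : SpecialRung L := ((rungOne_iff (L := L)).mp h).2

/-- HONESTY KERNEL: modulo the decided half, the located residual IS the rung. [folklore] -/
theorem specialRung_iff_rungOne (hG : GenericRung L) : SpecialRung L ↔ MaxContactCut.RungOne :=
  ⟨fun hS => (rungOne_iff (L := L)).mpr ⟨hG, hS⟩, specialRung_of_rungOne⟩

/-- **DECIDING IMPLICATION** for the leaf `L`: `MaxContactCut.RungOne` (29273) BY NAME from the two halves. [folklore] -/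
theorem closes (hG : GenericRung L) (hS : SpecialRung L) : MaxContactCut.RungOne :=
  (rungOne_iff (L := L)).mpr ⟨hG, hS⟩

/-- The decided half contains the tree's g13 `LeafGenericRung` (33865 BY NAME through
`MaxContactCut.LeafGenericRung`). [folklore] -/
theorem leafGenericRung_of_genericRung (hG : GenericRung L) : MaxContactCut.LeafGenericRung :=
  fun hE2 n hn => seqLGen_of_seqGen (hG hE2 n hn)

/-- The located residual is contained in the tree's g13 `LeafSpecialRung` (33866 BY NAME): `LeafSpecialRung →
SpecialRung L`. [folklore] -/
theorem specialRung_of_leafSpecialRung (h : MaxContactCut.LeafSpecialRung) : SpecialRung L :=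
  fun hE2 n hn => seqSpec_of_seqLSpec (h hE2 n hn)

/-- **EXACT RE-LOCATION OF THE TREE ASIDE 33866** `MaxContactCut.LeafSpecialRung` by the cut with ANY leaf `L`,
modulo the decided
half of `L`: `LeafSpecialRung ⟺ SpecialRung L`. [folklore] -/
theorem leafSpecialRung_iff_specialRung (hG : GenericRung L) : MaxContactCut.LeafSpecialRung ↔ SpecialRung L :=
  ⟨specialRung_of_leafSpecialRung,
    fun hS => CurveLeafExit.leafSpecialRung_of_rungOne (closes hG hS)⟩

variable {L' : ∀ ⦃Y : Scheme.{0}⦄, Y.IdealSheafData → ℕ → Y → Prop}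

/-- **EXACT RE-LOCATION SCHEMA**: modulo the bigger leaf's decided half, the smaller leaf's residual IS the bigger
leaf's residual.
[folklore] -/
theorem specialRung_iff_of_le (hLL' : ∀ ⦃Y : Scheme.{0}⦄ (I : Y.IdealSheafData) (n : ℕ) (y : Y), L I n y → L' I n y)
    (hG' : GenericRung L') : SpecialRung L ↔ SpecialRung L' :=
  ⟨specialRung_mono hLL', fun hS' => specialRung_of_rungOne (closes hG' hS')⟩

end Kernels

end Leaf

namespace Grand

section Kernels

variable {n : ℕ}

/-- **EXACT AT THE RUNG**: `RungOne ⟺ GrandGenericRung ∧ GrandSpecialRung`. [folklore] -/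
theorem rungOne_iff : MaxContactCut.RungOne ↔ GrandGenericRung ∧ GrandSpecialRung :=
  Leaf.rungOne_iff (L := grandLeaf)

/-- NECESSITY by letter. [folklore] -/
theorem grandGenericRung_of_rungOne (h : MaxContactCut.RungOne) : GrandGenericRung := (rungOne_iff.mp h).1

/-- NECESSITY by letter. [folklore] -/
theorem grandSpecialRung_of_rungOne (h : MaxContactCut.RungOne) : GrandSpecialRung := (rungOne_iff.mp h).2

/-- HONESTY KERNEL: modulo the decided half, the located residual IS the rung (cofinal). [folklore] -/
theorem grandSpecialRung_iff_rungOne (hG : GrandGenericRung) : GrandSpecialRung ↔ MaxContactCut.RungOne :=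
  Leaf.specialRung_iff_rungOne (L := grandLeaf) hG

/-- **DECIDING IMPLICATION OF THE NODE**: `MaxContactCut.RungOne` (29273) BY NAME from the two halves. [folklore] -/
theorem closes (hG : GrandGenericRung) (hS : GrandSpecialRung) : MaxContactCut.RungOne :=
  Leaf.closes (L := grandLeaf) hG hS

/-- `RungOne` BY NAME from the engines, the ports and the located residual. [folklore] -/
theorem closes_of_engines (hV : VeryNearCutClasses.VeryNearExit) (hD : DeltaPackageExit)
    (hU : UniformCurvePackageExit) (hR : RelCurvePackageExit) (hN : NormalConeJumpExit)
    (hM : MonomialPinchExit) (hC : FlatConeExit) (hGE : GrandExit)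
    (hP : ∀ n : ℕ, 2 ≤ n → CurvePackagePort n) (h1 : FaceFormCutClasses.OrderOneContact)
    (hS : GrandSpecialRung) : MaxContactCut.RungOne :=
  closes (grandGenericRung_of_engines hV hD hU hR hN hM hC hGE hP h1) hS

/-- **EXACT RE-LOCATION OF `Vast.VastSpecialRung`** (critic row 133 (b)): modulo the grand decided half,
`Vast.VastSpecialRung ⟺ GrandSpecialRung`. [folklore] -/
theorem vastSpecialRung_iff_grandSpecialRung (hG : GrandGenericRung) : Vast.VastSpecialRung ↔ GrandSpecialRung :=
  vastSpecialRung_iff.trans (Leaf.specialRung_iff_of_le vastLeaf_le_grandLeaf hG)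

/-- **EXACT RE-LOCATION OF THE TREE ASIDE 33866** `MaxContactCut.LeafSpecialRung` BY NAME: modulo the grand decided half,
`LeafSpecialRung ⟺ GrandSpecialRung`. [folklore] -/
theorem leafSpecialRung_iff_grandSpecialRung (hG : GrandGenericRung) : MaxContactCut.LeafSpecialRung ↔ GrandSpecialRung :=
  Leaf.leafSpecialRung_iff_specialRung (L := grandLeaf) hG

/-- The tree aside 33865 `MaxContactCut.LeafGenericRung` BY NAME from the grand decided half. [folklore] -/
theorem leafGenericRung_of_grandGenericRung (hG : GrandGenericRung) : MaxContactCut.LeafGenericRung :=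
  Leaf.leafGenericRung_of_genericRung (L := grandLeaf) hG

/-- **EXACT RE-LOCATION OF g14's `PinchSpecialRung`**: modulo the grand decided half, `PinchSpecialRung ⟺
GrandSpecialRung`. [folklore] -/
theorem pinchSpecialRung_iff_grandSpecialRung (hG : GrandGenericRung) : PinchSpecialRung ↔ GrandSpecialRung :=
  pinchSpecialRung_iff.trans (Leaf.specialRung_iff_of_le pinchLeaf_le_grandLeaf hG)

/-- `RungOne` BY NAME from the grand decided half and g15's residual (the old residual still closes). [folklore] -/
theorem closes_of_vastSpecialRung (hG : GrandGenericRung) (hS : Vast.VastSpecialRung) : MaxContactCut.RungOne :=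
  closes hG (grandSpecialRung_of_vastSpecialRung hS)

end Kernels

end Grand

end Summit.ResolutionOfSingularities.ResolutionOfSingularities.Theorems.PurityCut
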